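import Literature.Topology.FourManifolds.Gluing
import HarnessLib

/-!
# The pieces of a gluing along the boundary: seam, interiors, closedness

Topic `Literature/Topology/FourManifolds` (namespace `Literature.Topology.FourManifolds`). A small
companion of `Gluing.lean` recording the elementary point-set dictionary between the tree's
*relational* gluing predicate `IsBoundaryGluing bM bN φ IP P` ("`P = M ∪_φ N`": smooth embeddings
`jM : M → P`, `jN : N → P` whose ranges cover `P` and with `jM a = jN b ↔ ∃ z, a = incl z ∧
b = incl (φ z)`) and the classical description `P = M₁ ∪_Σ M₂` of a closed manifold split along a
closed two-sided hypersurface `Σ` into two compact pieces meeting exactly along their common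
boundary (Hirsch, *Differential Topology* (1976), §8.2; Bröcker–Jänich (1982), §13) — the
setting of Bär–Hanke, §4.4 ("`M̂ = M₁ ∪_Σ M₂`, where `M₁` and `M₂` are smooth manifolds with compact
boundary `Σ`"), needed to feed the named fact `Literature.Geometry.Riemannian.BaerHankePscGluing`
(`Geometry/Riemannian/BaerHankeGluing.lean`) with its source. For gluing maps `jM`, `jN` as above:

* `seam_eq` — on the boundary the two embeddings agree: `jM ∘ incl_M = jN ∘ incl_N ∘ φ`;
* `range_inter_range_eq` — the pieces meet exactly along the seam:
  `range jM ∩ range jN = range (jM ∘ incl_M)` (`= Σ`);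
* `image_interior_eq_compl_range` (and `…'` for the other piece) — the image of the interior
  of `M` is the complement of the other piece, `jM '' Int M = (range jN)ᶜ`; hence
* `isOpen_image_interior` — `jM '' Int M` is OPEN in `P` as soon as `range jN` is closed (e.g.
  `N` compact, `P` Hausdorff: `isClosed_range_of_compactSpace`), with no appeal to invariance of
  domain;
* `IsBoundaryGluing.exists_pieces` — the packaged form for compact pieces in a Hausdorff `P`.

Everything is proved; no definitions and no named facts are introduced.

## References

* M. W. Hirsch, *Differential Topology*, GTM 33, Springer 1976, §8.2 (`M ∪_f N`). [Hirsch1976]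
* C. Bär, B. Hanke, *Boundary conditions for scalar curvature*, arXiv:2012.09127, §4.4 (the
  setting `M̂ = M₁ ∪_Σ M₂`). [BarHanke2023]
-/

open scoped Manifold ContDiff Topology
open Set Function

noncomputable section

namespace Literature.Topology.FourManifolds

universe u

section Pieces

variable {EM HM EN HN E₀ H₀ E₀' H₀' : Type*}
  [NormedAddCommGroup EM] [NormedSpace ℝ EM] [TopologicalSpace HM] {IM : ModelWithCorners ℝ EM HM}
  [NormedAddCommGroup EN] [NormedSpace ℝ EN] [TopologicalSpace HN] {IN : ModelWithCorners ℝ EN HN}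
  [NormedAddCommGroup E₀] [NormedSpace ℝ E₀] [TopologicalSpace H₀] {I₀ : ModelWithCorners ℝ E₀ H₀}
  [NormedAddCommGroup E₀'] [NormedSpace ℝ E₀'] [TopologicalSpace H₀']
  {I₀' : ModelWithCorners ℝ E₀' H₀'}
  {M : Type u} [TopologicalSpace M] [ChartedSpace HM M]
  {N : Type u} [TopologicalSpace N] [ChartedSpace HN N]
  {bM : BoundaryData IM M I₀} {bN : BoundaryData IN N I₀'} {φ : bM.carrier → bN.carrier}
  {P : Type*} {jM : M → P} {jN : N → P}

/-- **The two gluing maps agree along the boundary**: if `jM a = jN b ↔ ∃ z, a = incl z ∧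
b = incl (φ z)` (the gluing relation of `IsBoundaryGluing`), then `jM ∘ incl_M = jN ∘ incl_N ∘ φ`
— the seam `Σ ⊂ P` is the common image of `∂M` and `∂N`. Hirsch (1976), §8.2. [cite: Hirsch1976, §8.2] -/
theorem seam_eq (hR : ∀ a b, jM a = jN b ↔ ∃ z, a = bM.incl z ∧ b = bN.incl (φ z)) :
    jM ∘ bM.incl = jN ∘ bN.incl ∘ φ :=
  funext fun z ↦ (hR (bM.incl z) (bN.incl (φ z))).mpr ⟨z, rfl, rfl⟩

/-- **The pieces meet exactly along the seam**: under the gluing relation,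
`range jM ∩ range jN = range (jM ∘ incl_M)`. Hirsch (1976), §8.2 ("`M` and `N` meet along
`∂M ≡ ∂N`"). [cite: Hirsch1976, §8.2] -/
theorem range_inter_range_eq (hR : ∀ a b, jM a = jN b ↔ ∃ z, a = bM.incl z ∧ b = bN.incl (φ z)) :
    range jM ∩ range jN = range (jM ∘ bM.incl) := by
  ext p
  constructor
  · rintro ⟨⟨a, rfl⟩, ⟨b, hb⟩⟩
    obtain ⟨z, rfl, -⟩ := (hR a b).mp hb.symm
    exact ⟨z, rfl⟩
  · rintro ⟨z, rfl⟩
    refine ⟨⟨bM.incl z, rfl⟩, ⟨bN.incl (φ z), ?_⟩⟩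
    exact ((hR (bM.incl z) (bN.incl (φ z))).mpr ⟨z, rfl, rfl⟩).symm

/-- **The interior of a piece is the complement of the other piece**: if the ranges of `jM`,
`jN` cover `P` and the gluing relation holds, then `jM '' Int M = (range jN)ᶜ`, where
`Int M = (∂M)ᶜ` is Mathlib's `IM.interior M` and `∂M = range incl_M` (`BoundaryData.range_incl`).
Hirsch (1976), §8.2. [cite: Hirsch1976, §8.2] -/
theorem image_interior_eq_compl_range (hU : range jM ∪ range jN = univ)
    (hR : ∀ a b, jM a = jN b ↔ ∃ z, a = bM.incl z ∧ b = bN.incl (φ z)) :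
    jM '' (IM.interior M) = (range jN)ᶜ := by
  ext p
  simp only [mem_image, mem_compl_iff, mem_range, not_exists]
  constructor
  · rintro ⟨a, ha, rfl⟩ b hb
    obtain ⟨z, rfl, -⟩ := (hR a b).mp hb.symm
    rw [← ModelWithCorners.compl_boundary, mem_compl_iff, ← bM.range_incl] at ha
    exact ha ⟨z, rfl⟩
  · intro hp
    have hpM : p ∈ range jM := by
      have : p ∈ range jM ∪ range jN := hU ▸ mem_univ p
      exact this.resolve_right fun ⟨b, hb⟩ ↦ hp b hb
    obtain ⟨a, rfl⟩ := hpM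
    refine ⟨a, ?_, rfl⟩
    rw [← ModelWithCorners.compl_boundary, mem_compl_iff, ← bM.range_incl]
    rintro ⟨z, rfl⟩
    exact hp (bN.incl (φ z)) ((hR (bM.incl z) (bN.incl (φ z))).mpr ⟨z, rfl, rfl⟩).symm

/-- The symmetric statement for the second piece: `jN '' Int N = (range jM)ᶜ`, for a gluing
relation along a bijection `φ : ∂M ≃ ∂N`. Hirsch (1976), §8.2. [cite: Hirsch1976, §8.2] -/
theorem image_interior_eq_compl_range' {φ : bM.carrier ≃ bN.carrier}
    (hU : range jM ∪ range jN = univ)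
    (hR : ∀ a b, jM a = jN b ↔ ∃ z, a = bM.incl z ∧ b = bN.incl (φ z)) :
    jN '' (IN.interior N) = (range jM)ᶜ := by
  refine image_interior_eq_compl_range (bM := bN) (bN := bM) (φ := φ.symm)
    ((union_comm _ _).trans hU) fun b a ↦ ?_
  rw [eq_comm, hR a b]
  constructor
  · rintro ⟨z, rfl, rfl⟩
    exact ⟨φ z, rfl, by simp⟩
  · rintro ⟨w, rfl, rfl⟩
    exact ⟨φ.symm w, rfl, by simp⟩

variable [TopologicalSpace P]

/-- The range of a continuous map from a compact space into a Hausdorff space is closed (the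
pieces `jM(M)`, `jN(N)` of a gluing of compact manifolds are closed in `P`). [folklore] -/
theorem isClosed_range_of_compactSpace [CompactSpace M] [T2Space P] (hj : Continuous jM) :
    IsClosed (range jM) :=
  (isCompact_range hj).isClosed

/-- **The image of the interior of a piece is open** in the glued space, as the complement of
the (closed) other piece — no invariance of domain is needed. Hirsch (1976), §8.2. [cite: Hirsch1976, §8.2] -/
theorem isOpen_image_interior (hU : range jM ∪ range jN = univ)
    (hR : ∀ a b, jM a = jN b ↔ ∃ z, a = bM.incl z ∧ b = bN.incl (φ z))
    (hN : IsClosed (range jN)) : IsOpen (jM '' (IM.interior M)) := by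
  rw [image_interior_eq_compl_range hU hR]
  exact hN.isOpen_compl

end Pieces

section Packaged

variable {EM HM EN HN E₀ H₀ E₀' H₀' EP HP : Type*}
  [NormedAddCommGroup EM] [NormedSpace ℝ EM] [TopologicalSpace HM] {IM : ModelWithCorners ℝ EM HM}
  [NormedAddCommGroup EN] [NormedSpace ℝ EN] [TopologicalSpace HN] {IN : ModelWithCorners ℝ EN HN}
  [NormedAddCommGroup E₀] [NormedSpace ℝ E₀] [TopologicalSpace H₀] {I₀ : ModelWithCorners ℝ E₀ H₀}
  [NormedAddCommGroup E₀'] [NormedSpace ℝ E₀'] [TopologicalSpace H₀']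
  {I₀' : ModelWithCorners ℝ E₀' H₀'}
  [NormedAddCommGroup EP] [NormedSpace ℝ EP] [TopologicalSpace HP] {IP : ModelWithCorners ℝ EP HP}
  {M : Type u} [TopologicalSpace M] [ChartedSpace HM M]
  {N : Type u} [TopologicalSpace N] [ChartedSpace HN N]
  {bM : BoundaryData IM M I₀} {bN : BoundaryData IN N I₀'}
  {P : Type*} [TopologicalSpace P] [ChartedSpace HP P]

/-- **The pieces of a gluing `P = M ∪_φ N` of compact manifolds** (the dictionary with
"`M̂ = M₁ ∪_Σ M₂`, `M₁, M₂` smooth manifolds with compact boundary `Σ`", Bär–Hanke §4.4;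
Hirsch (1976), §8.2): for compact `M`, `N` glued along a bijection `φ : ∂M ≃ ∂N` into a Hausdorff
`P`, there are smooth embeddings `jM`, `jN` with: ranges covering `P`; the gluing relation; both
ranges closed; `jM ∘ incl_M = jN ∘ incl_N ∘ φ` (the seam `Σ`); `range jM ∩ range jN = Σ`; and
the images of the interiors are the OPEN sets `(range jN)ᶜ`, `(range jM)ᶜ`. [cite: Hirsch1976, §8.2] -/
theorem IsBoundaryGluing.exists_pieces [CompactSpace M] [CompactSpace N] [T2Space P]
    {φ : bM.carrier ≃ bN.carrier} (h : IsBoundaryGluing bM bN φ IP P) :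
    ∃ (jM : M → P) (jN : N → P), Manifold.IsSmoothEmbedding IM IP ∞ jM ∧
      Manifold.IsSmoothEmbedding IN IP ∞ jN ∧ range jM ∪ range jN = univ ∧
      (∀ a b, jM a = jN b ↔ ∃ z, a = bM.incl z ∧ b = bN.incl (φ z)) ∧
      IsClosed (range jM) ∧ IsClosed (range jN) ∧
      jM ∘ bM.incl = jN ∘ bN.incl ∘ φ ∧
      range jM ∩ range jN = range (jM ∘ bM.incl) ∧
      jM '' (IM.interior M) = (range jN)ᶜ ∧ IsOpen (jM '' (IM.interior M)) ∧
      jN '' (IN.interior N) = (range jM)ᶜ ∧ IsOpen (jN '' (IN.interior N)) := by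
  obtain ⟨jM, jN, hM, hN, hU, hR⟩ := h
  have hcM : IsClosed (range jM) := isClosed_range_of_compactSpace hM.isEmbedding.continuous
  have hcN : IsClosed (range jN) := isClosed_range_of_compactSpace hN.isEmbedding.continuous
  have h1 := image_interior_eq_compl_range hU hR
  have h2 := image_interior_eq_compl_range' hU hR
  exact ⟨jM, jN, hM, hN, hU, hR, hcM, hcN, seam_eq hR, range_inter_range_eq hR, h1,
    h1 ▸ hcN.isOpen_compl, h2, h2 ▸ hcM.isOpen_compl⟩

end Packaged

end Literature.Topology.FourManifolds

end
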